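import Summits.Ventures.PercRepro.Night2ExcessMassIndep
import Summits.Ventures.PercRepro.Night2SeriesClasses
import Summits.Ventures.PercRepro.Night2GeneralQPoly

/-!
# PercRepro — the arithmetic of the cell `(3, 2)` at every size (night-2, gen 24)

The cell `(3, 2)` of the `(7, 5)` shadow row (`|E ∖ G| = 3`, two coloops, `ρ = 4`, `capDG = 5/12`) has no bound on
`n = |G ∖ K|`.  This module carries the size-uniform arithmetic of its count assembly:

* the chord of `1/(m + 3)` on `[2, n − 3]`: `a = (n+2)/(5n)`, `b = 1/(5n)` (`chord_three_two`), and the excess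
  `excessBound 5 3 4 2 n a b = (n + 56)/(20n)` (`excessBound_three_two_eq`);
* the one-fat-pair count `cntSeries 4 s [2] = C(s−2, 2) + 2·C(s−2, 3)` (`cntSeries_four_two_eq`), positive for `s ≥ 4`
  and at most `C(s, 4)`;
* **`countSum_three_two_tail`**: `countSum n 4 3 (1/60) ((n+56)/(20n)) (cntSeries 4 · [2]) ≥ 1` for every `n ≥ 26` —
  the single middle term `j = ⌊(n−4)/2⌋` through `2^{n−4} ≤ (n−3)·C(n−4, ⌊(n−4)/2⌋)` and
  `3(n−3)(n+56)·C(n,4) ≤ 2^{n−4}·n` (`tail_three_two_aux`).  The kernel range `7 ≤ n ≤ 25` and the combined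
  statement are in `Night2ThreeTwoSums`.
-/

namespace PercRepro.Shadow

open Finset PerFlat ThmH

/-- The chord of `1/(m + 3)` on `[2, n − 3]`: `1/(m+3) ≤ (n+2)/(5n) − m/(5n)`, i.e. `5n ≤ (m+3)(n+2−m)`. -/
theorem chord_three_two {n : ℕ} (hn : 7 ≤ n) : ∀ m : ℕ, 2 ≤ m → m ≤ n - 4 + 1 →
    1 / ((m : ℚ) + ((3 : ℕ) : ℚ)) ≤ ((n : ℚ) + 2) / (5 * (n : ℚ)) - (1 / (5 * (n : ℚ))) * (m : ℚ) := by
  intro m h1 h2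
  have hm : (m : ℚ) ≤ (n : ℚ) - 3 := by
    have h3 : m + 3 ≤ n := by omega
    have h3' : ((m + 3 : ℕ) : ℚ) ≤ (n : ℚ) := by exact_mod_cast h3
    push_cast at h3'
    linarith
  have hm2 : (2 : ℚ) ≤ (m : ℚ) := by exact_mod_cast h1
  have hn' : (7 : ℚ) ≤ (n : ℚ) := by exact_mod_cast hn
  have hpos : (0 : ℚ) < (m : ℚ) + ((3 : ℕ) : ℚ) := by push_cast; linarith
  rw [div_le_iff₀ hpos]
  have : ((n : ℚ) + 2) / (5 * (n : ℚ)) - (1 / (5 * (n : ℚ))) * (m : ℚ) = ((n : ℚ) + 2 - m) / (5 * n) := by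
    field_simp
  rw [this, div_mul_eq_mul_div, le_div_iff₀ (by positivity)]
  push_cast
  nlinarith [mul_nonneg (sub_nonneg.2 hm2) (sub_nonneg.2 hm)]

/-- `excessBound 5 3 4 2 n ((n+2)/(5n)) (1/(5n)) = (n + 56)/(20n)`. -/
theorem excessBound_three_two_eq {n : ℕ} (hn : 7 ≤ n) :
    excessBound 5 3 4 2 n (((n : ℚ) + 2) / (5 * (n : ℚ))) (1 / (5 * (n : ℚ))) = ((n : ℚ) + 56) / (20 * (n : ℚ)) := by
  have hn' : (n : ℚ) ≠ 0 := by exact_mod_cast (by omega : n ≠ 0)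
  unfold excessBound capDG phiQ
  field_simp
  ring

/-- `(n + 56)/(20n) > 0`. -/
theorem excess_three_two_pos {n : ℕ} (hn : 7 ≤ n) : (0 : ℚ) < ((n : ℚ) + 56) / (20 * (n : ℚ)) := by
  have : (0 : ℚ) < (n : ℚ) := by exact_mod_cast (by omega : 0 < n)
  positivity

/-- `(n + 56)/(20n) ≤ 9/20` for `n ≥ 7`. -/
theorem excess_three_two_le {n : ℕ} (hn : 7 ≤ n) : ((n : ℚ) + 56) / (20 * (n : ℚ)) ≤ 9 / 20 := by
  have hn' : (7 : ℚ) ≤ (n : ℚ) := by exact_mod_cast hn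
  rw [div_le_iff₀ (by positivity)]
  linarith

/-- The one-fat-pair count: `cntSeries 4 s [2] = C(s−2, 2) + 2·C(s−2, 3)`. -/
theorem cntSeries_four_two_eq (s : ℕ) : cntSeries 4 s [2] = (s - 2).choose 2 + 2 * (s - 2).choose 3 := by
  simp [cntSeries]

/-- `cntSeries 4 s [2] > 0` for `s ≥ 4`. -/
theorem cntSeries_four_two_pos {s : ℕ} (hs : 4 ≤ s) : 0 < (cntSeries 4 s [2] : ℚ) := by
  rw [cntSeries_four_two_eq]
  have : 0 < (s - 2).choose 2 := Nat.choose_pos (by omega)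
  exact_mod_cast (by omega : 0 < (s - 2).choose 2 + 2 * (s - 2).choose 3)

/-- `cntSeries 4 s [2] ≤ C(s, 4)`: `C(s,4) = C(s−2,4) + 2C(s−2,3) + C(s−2,2)`. -/
theorem cntSeries_four_two_le_choose {s : ℕ} (hs : 2 ≤ s) : cntSeries 4 s [2] ≤ s.choose 4 := by
  rw [cntSeries_four_two_eq]
  obtain ⟨r, rfl⟩ : ∃ r, s = r + 2 := ⟨s - 2, by omega⟩
  simp only [Nat.add_sub_cancel]
  have h1 : (r + 2).choose 4 = (r + 1).choose 3 + (r + 1).choose 4 := Nat.choose_succ_succ (r + 1) 3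
  have h2 : (r + 1).choose 4 = r.choose 3 + r.choose 4 := Nat.choose_succ_succ r 3
  have h3 : (r + 1).choose 3 = r.choose 2 + r.choose 3 := Nat.choose_succ_succ r 2
  omega

/-- The algebraic step of the tail induction, with the binomials abstracted: from
`3(m+23)(m+82)·C ≤ P·(m+26)` and `C'·(m+23) = (m+27)·C` to `3(m+24)(m+83)·C' ≤ 2P·(m+27)`. -/
theorem tail_three_two_step (m : ℕ) (C C' P : ℚ) (hC0 : 0 ≤ C)
    (hC : C' * ((m : ℚ) + 23) = ((m : ℚ) + 27) * C)
    (ih : 3 * ((m : ℚ) + 23) * ((m : ℚ) + 82) * C ≤ P * ((m : ℚ) + 26)) :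
    3 * ((m : ℚ) + 24) * ((m : ℚ) + 83) * C' ≤ 2 * P * ((m : ℚ) + 27) := by
  have hm : (0 : ℚ) ≤ (m : ℚ) := Nat.cast_nonneg m
  have hpoly : ((m : ℚ) + 24) * ((m : ℚ) + 83) * ((m : ℚ) + 26) ≤ 2 * ((m : ℚ) + 23) ^ 2 * ((m : ℚ) + 82) := by
    have e : 2 * ((m : ℚ) + 23) ^ 2 * ((m : ℚ) + 82) - ((m : ℚ) + 24) * ((m : ℚ) + 83) * ((m : ℚ) + 26) =
        (m : ℚ) ^ 3 + 123 * (m : ℚ) ^ 2 + 3828 * (m : ℚ) + 34964 := by ring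
    have : 0 ≤ (m : ℚ) ^ 3 + 123 * (m : ℚ) ^ 2 + 3828 * (m : ℚ) + 34964 := by positivity
    linarith
  have h1 : 0 ≤ ((m : ℚ) + 27) * C * (2 * ((m : ℚ) + 23) ^ 2 * ((m : ℚ) + 82) -
      ((m : ℚ) + 24) * ((m : ℚ) + 83) * ((m : ℚ) + 26)) :=
    mul_nonneg (mul_nonneg (by linarith) hC0) (sub_nonneg.2 hpoly)
  have h2 : 0 ≤ 2 * ((m : ℚ) + 27) * ((m : ℚ) + 23) * (P * ((m : ℚ) + 26) - 3 * ((m : ℚ) + 23) * ((m : ℚ) + 82) * C) :=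
    mul_nonneg (by positivity) (sub_nonneg.2 ih)
  have hfinal : 0 ≤ 2 * P * ((m : ℚ) + 27) * ((m : ℚ) + 23) * ((m : ℚ) + 26) -
      3 * ((m : ℚ) + 24) * ((m : ℚ) + 83) * (((m : ℚ) + 27) * C) * ((m : ℚ) + 26) := by
    have e : 2 * P * ((m : ℚ) + 27) * ((m : ℚ) + 23) * ((m : ℚ) + 26) -
        3 * ((m : ℚ) + 24) * ((m : ℚ) + 83) * (((m : ℚ) + 27) * C) * ((m : ℚ) + 26) =
        3 * (((m : ℚ) + 27) * C * (2 * ((m : ℚ) + 23) ^ 2 * ((m : ℚ) + 82) -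
          ((m : ℚ) + 24) * ((m : ℚ) + 83) * ((m : ℚ) + 26))) +
        2 * ((m : ℚ) + 27) * ((m : ℚ) + 23) * (P * ((m : ℚ) + 26) - 3 * ((m : ℚ) + 23) * ((m : ℚ) + 82) * C) := by
      ring
    rw [e]
    exact add_nonneg (mul_nonneg (by norm_num) h1) h2
  have hpos : (0 : ℚ) < ((m : ℚ) + 23) * ((m : ℚ) + 26) := by positivity
  refine le_of_mul_le_mul_right ?_ hpos
  have e : 3 * ((m : ℚ) + 24) * ((m : ℚ) + 83) * C' * (((m : ℚ) + 23) * ((m : ℚ) + 26)) =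
      3 * ((m : ℚ) + 24) * ((m : ℚ) + 83) * (C' * ((m : ℚ) + 23)) * ((m : ℚ) + 26) := by ring
  rw [e, hC]
  linarith

/-- **The tail inequality** `3(n − 3)(n + 56)·C(n, 4) ≤ 2^{n−4}·n` for `n ≥ 26`, in the form `n = m + 26`. -/
theorem tail_three_two_aux (m : ℕ) :
    (3 : ℚ) * ((m : ℚ) + 23) * ((m : ℚ) + 82) * (((m + 26).choose 4 : ℕ) : ℚ) ≤ 2 ^ (m + 22) * ((m : ℚ) + 26) := by
  induction m with
  | zero => norm_num [Nat.choose_eq_descFactorial_div_factorial, Nat.descFactorial, Nat.factorial]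
  | succ m ih =>
    have hC : (((m + 27).choose 4 : ℕ) : ℚ) * ((m : ℚ) + 23) = ((m : ℚ) + 27) * (((m + 26).choose 4 : ℕ) : ℚ) := by
      have := choose_four_succ_mul (m + 26)
      rw [show m + 26 + 1 = m + 27 by omega, show m + 26 - 3 = m + 23 by omega] at this
      exact_mod_cast this
    have hC0 : (0 : ℚ) ≤ (((m + 26).choose 4 : ℕ) : ℚ) := Nat.cast_nonneg _
    have step := tail_three_two_step m _ _ _ hC0 hC ih
    have e1 : ((m + 1 : ℕ) : ℚ) = (m : ℚ) + 1 := by push_cast; ring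
    have e2 : (2 : ℚ) ^ (m + 1 + 22) = 2 * 2 ^ (m + 22) := by ring
    have e3 : m + 1 + 26 = m + 27 := by omega
    rw [e1, e2, e3]
    calc (3 : ℚ) * ((m : ℚ) + 1 + 23) * ((m : ℚ) + 1 + 82) * (((m + 27).choose 4 : ℕ) : ℚ)
        = 3 * ((m : ℚ) + 24) * ((m : ℚ) + 83) * (((m + 27).choose 4 : ℕ) : ℚ) := by ring
      _ ≤ 2 * 2 ^ (m + 22) * ((m : ℚ) + 27) := step
      _ = 2 * 2 ^ (m + 22) * ((m : ℚ) + 1 + 26) := by ring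


/-- **The tail `n ≥ 26`**: the single middle term `j = ⌊(n−4)/2⌋` of the count sum is already `≥ 1`. -/
theorem countSum_three_two_tail {n : ℕ} (hn : 26 ≤ n) :
    1 ≤ countSum n 4 3 (1 / 60 : ℚ) (((n : ℚ) + 56) / (20 * (n : ℚ))) (fun s => (cntSeries 4 s [2] : ℚ)) := by
  set E : ℚ := ((n : ℚ) + 56) / (20 * (n : ℚ)) with hE
  have hEpos : 0 < E := excess_three_two_pos (by omega)
  set j₀ := (n - 4) / 2 with hj₀
  have hj₀mem : j₀ ∈ Finset.Icc 1 (n - 4) := by rw [Finset.mem_Icc]; omega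
  have hcj : DGenP.cjG n 4 3 j₀ (1 / 60 : ℚ) = 1 / 60 := by
    unfold DGenP.cjG; rw [if_pos (by omega)]
  -- every term is nonnegative
  have hterm_nonneg : ∀ j ∈ Finset.Icc 1 (n - 4), (0 : ℚ) ≤
      ((n - 4).choose j : ℚ) * (DGenP.cjG n 4 3 j (1 / 60 : ℚ) / ((cntSeries 4 (j + 4) [2] : ℚ) * E)) := by
    intro j _
    apply mul_nonneg (by positivity)
    apply div_nonneg
    · unfold DGenP.cjG; split_ifs <;> norm_num
    · exact mul_nonneg (by positivity) hEpos.le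
  have hsingle := Finset.single_le_sum hterm_nonneg hj₀mem
  unfold countSum
  refine le_trans ?_ hsingle
  rw [hcj]
  -- the middle term is ≥ 1: C(n−4, j₀) ≥ 60 · cnt(j₀ + 4) · E
  have hcntpos : (0 : ℚ) < (cntSeries 4 (j₀ + 4) [2] : ℚ) := cntSeries_four_two_pos (by omega)
  rw [mul_div_assoc', le_div_iff₀ (mul_pos hcntpos hEpos)]
  -- the three ingredients
  have h1 : (2 : ℚ) ^ (n - 4) ≤ ((n : ℚ) - 3) * ((n - 4).choose j₀ : ℚ) := by
    have := two_pow_le_succ_mul_choose_middle (n - 4)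
    have e : ((n - 4 + 1 : ℕ) : ℚ) = (n : ℚ) - 3 := by
      rw [Nat.cast_add, Nat.cast_sub (by omega : 4 ≤ n)]; push_cast; ring
    have h' : ((2 ^ (n - 4) : ℕ) : ℚ) ≤ (((n - 4 + 1) * (n - 4).choose ((n - 4) / 2) : ℕ) : ℚ) := by exact_mod_cast this
    push_cast at h'
    rw [Nat.cast_sub (by omega : 4 ≤ n)] at h'
    push_cast at h'
    rw [hj₀]
    linarith
  have h2 : (cntSeries 4 (j₀ + 4) [2] : ℚ) ≤ (n.choose 4 : ℚ) := by
    have ha := cntSeries_four_two_le_choose (s := j₀ + 4) (by omega)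
    have hb : (j₀ + 4).choose 4 ≤ n.choose 4 := Nat.choose_le_choose 4 (by omega)
    exact_mod_cast ha.trans hb
  have h3 : 3 * ((n : ℚ) - 3) * ((n : ℚ) + 56) * (n.choose 4 : ℚ) ≤ 2 ^ (n - 4) * (n : ℚ) := by
    obtain ⟨m, rfl⟩ : ∃ m, n = m + 26 := ⟨n - 26, by omega⟩
    have := tail_three_two_aux m
    rw [show m + 26 - 4 = m + 22 by omega]
    push_cast
    have e1 : (m : ℚ) + 26 - 3 = (m : ℚ) + 23 := by ring
    have e2 : (m : ℚ) + 26 + 56 = (m : ℚ) + 82 := by ring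
    rw [e1, e2]
    exact this
  have hn3 : (0 : ℚ) < (n : ℚ) - 3 := by
    have : (26 : ℚ) ≤ (n : ℚ) := by exact_mod_cast hn
    linarith
  have hnpos : (0 : ℚ) < (n : ℚ) := by
    have : (26 : ℚ) ≤ (n : ℚ) := by exact_mod_cast hn
    linarith
  -- 1 · (cnt · E) ≤ C(n−4, j₀) · (1/60)  ⟺  60 · cnt · E ≤ C(n−4, j₀)
  have hE' : E = ((n : ℚ) + 56) / (20 * (n : ℚ)) := hE
  rw [hE']
  have hcnt' : (cntSeries 4 (j₀ + 4) [2] : ℚ) * (((n : ℚ) + 56) / (20 * (n : ℚ))) ≤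
      (n.choose 4 : ℚ) * (((n : ℚ) + 56) / (20 * (n : ℚ))) :=
    mul_le_mul_of_nonneg_right h2 (by positivity)
  have hkey : (n.choose 4 : ℚ) * (((n : ℚ) + 56) / (20 * (n : ℚ))) ≤ ((n - 4).choose j₀ : ℚ) * (1 / 60) := by
    rw [mul_div_assoc', div_le_iff₀ (by positivity)]
    -- C(n,4)(n+56) ≤ C(n−4,j₀)·(20n)/60 = C(n−4,j₀)·n/3  ⟸  3(n−3)(n+56)C(n,4) ≤ 2^{n−4} n ≤ (n−3) C(n−4,j₀) n
    have := mul_le_mul_of_nonneg_right h1 hnpos.le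
    nlinarith [h3, this, hn3]
  calc 1 * ((cntSeries 4 (j₀ + 4) [2] : ℚ) * E) = (cntSeries 4 (j₀ + 4) [2] : ℚ) * E := one_mul _
    _ ≤ ((n - 4).choose j₀ : ℚ) * (1 / 60) := by rw [hE']; exact hcnt'.trans hkey


end PercRepro.Shadow
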